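import Mathlib
import HarnessLib

/-!
# Named fact: Glynn's formula for the permanent

Topic `Literature/Computability/AlgebraicComplexity` (permanent versus determinant; exact
exponential-size expressions for `per_n`). Grounder file (D-0014 named facts) for the route
`ValiantsHypothesis/GrenetZeon`, statement item stmt-ValiantsHypothesis-8067
(`GrenetZeon.GlynnPoint`: the Glynn point `(n, 2^{n-1})` of the two-parameter determinantal
model — `per_n` is an `n × n` DIAGONAL determinant over the semisimple algebra `ℂ^{2^{n-1}}`,
read through a linear functional; that item is exactly this formula packaged over the product
algebra indexed by `{δ ∈ {±1}^n : δ₁ = 1}`).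

In print (primary): D. G. Glynn, *The permanent of a square matrix*, European J. Combin. 31
(2010) 1887–1891 [Glynn2010] — paywalled on this hub (acquisition request acq-02540); the
theorem number is to be sharpened on reground. Verbatim secondary statement (held, read
2026-08-15): S. Aaronson, T. Hance, *Generalizing and derandomizing Gurvits's approximation
algorithm for the permanent*, Quantum Inf. Comput. 14 (2014) = arXiv:1212.0025, §2, eqs. (2)–(3):
"we will use a similar formula due to Glynn [Gly10], which pulls from the domain `{−1,1}^n` rather
than `{0,1}^n` … define the Glynn estimator of an `n × n` matrix `A` as
`Gly_x(A) := x_1 ⋯ x_n ∏_{i=1}^n (a_{i,1} x_1 + ⋯ + a_{i,n} x_n)`. Then we have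
`Per(A) = E_{x ∈ {−1,1}^n}[Gly_x(A)]`", with the one-line proof "`E[(x_1⋯x_n)(x_{σ_1}⋯x_{σ_n})]`
is `1` if the map `i ↦ σ_i` is a permutation, and `0` otherwise". Halving the sum by the symmetry
`x ↦ −x` gives Glynn's printed normalisation `per(A) = 2^{1-n} ∑_{δ ∈ {±1}^n, δ₁ = 1} (∏_k δ_k)
∏_j ∑_i δ_i a_{ij}` (transpose-invariant: `Matrix.permanent_transpose`).

Rendering: the expectation is cleared of denominators (`2^n · per A = ∑_{x ∈ {±1}^n} …`), so the
statement is over an arbitrary commutative ring (the printed argument is characteristic-free in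
this form; over `ℂ` divide by `2^n`). `{±1}^n` is `n → ℤˣ`, cast into `R`. Mathlib's
`Matrix.permanent M = ∑_σ ∏_i M (σ i) i` [Mathlib, `Matrix.permanent`]; Aaronson–Hance's
`∑_σ a_{1,σ_1} ⋯ a_{n,σ_n}` is the same number (`Matrix.permanent_transpose`), and the row form
`∏_i ∑_j a_{ij} x_j` printed by them is used verbatim below.

Nothing is asserted; users take `(h : glynn_permanent_formula)`. Elementary (expand the product
and use `∑_{x ∈ {±1}^n} ∏_k x_k^{1 + |f⁻¹(k)|} = 2^n · [f bijective]`), cf. the tree's Ryser-type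
identity `Literature.Computability.AlgebraicComplexity.sum_bool_sign_prod_sum_eq_sum_perm`
(`ValiantConjectureProofs.lean`), which is the `{0,1}^n` analogue; a literature-prover may
discharge it as `glynn_permanent_formula_holds`.

## References

* [Glynn2010] D. G. Glynn, *The permanent of a square matrix*, European J. Combin. 31 (2010)
  1887–1891, doi:10.1016/j.ejc.2010.01.010 (Glynn's formula).
* [AaronsonHance2012] S. Aaronson, T. Hance, *Generalizing and derandomizing Gurvits's
  approximation algorithm for the permanent*, arXiv:1212.0025 = Quantum Inf. Comput. 14 (2014),
  §2, eqs. (2)–(3) (verbatim secondary statement and proof of Glynn's formula).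
-/

namespace Literature.Computability.AlgebraicComplexity

open scoped BigOperators

/-- NAMED FACT (**Glynn's formula**, denominators cleared). For every commutative ring `R`,
finite index type `n` and matrix `A : Matrix n n R`,
`∑_{x ∈ {±1}^n} (∏_k x_k) · ∏_i (∑_j A i j · x_j) = 2^{|n|} · per A`,
where `per A = Matrix.permanent A = ∑_σ ∏_i A (σ i) i`. Printed form: "`Per(A) =
E_{x ∈ {−1,1}^n}[x_1 ⋯ x_n ∏_{i=1}^n (a_{i,1}x_1 + ⋯ + a_{i,n}x_n)]`" (Aaronson–Hance 2014, §2
eq. (3), "a similar formula due to Glynn"); Glynn 2010 prints the halved sum over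
`{δ : δ₁ = 1}` with the factor `2^{1-n}`. Grounds
`Summit.ValiantsHypothesis.ValiantsHypothesis.Theses.GrenetZeon.GlynnPoint` (item = this fact
packaged as a diagonal `n × n` determinant over the product algebra `ℂ^{{±1}^n/±}` with the
functional `r ↦ 2^{1-n} ∑_δ (∏_k δ_k) r_δ`). Users take `(h : glynn_permanent_formula)`.
[cite: Glynn2010] [cite: AaronsonHance2012, §2 eqs. (2)–(3)] -/
def glynn_permanent_formula : Prop :=
  ∀ {n : Type} [Fintype n] [DecidableEq n] {R : Type} [CommRing R] (A : Matrix n n R),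
    (∑ x : n → ℤˣ, (∏ k, ((x k : ℤ) : R)) * ∏ i, ∑ j, A i j * ((x j : ℤ) : R))
      = (2 : R) ^ Fintype.card n * A.permanent

/-- Sanity instance of the shape of `glynn_permanent_formula` at a `1 × 1` matrix: the fact
specialises to `∑_{x ∈ {±1}} x · (a · x) = 2 · a`. (Consequence of the fact, recorded to fix
the reading of the binders; not used elsewhere.) [cite: Glynn2010] -/
theorem glynn_permanent_formula.card_one (h : glynn_permanent_formula) {R : Type} [CommRing R]
    (A : Matrix (Fin 1) (Fin 1) R) :
    (∑ x : Fin 1 → ℤˣ, (∏ k, ((x k : ℤ) : R)) * ∏ i, ∑ j, A i j * ((x j : ℤ) : R))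
      = 2 * A.permanent := by
  simpa using h A

end Literature.Computability.AlgebraicComplexity
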